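import Summits.BirchSwinnertonDyer.Rank1Residual.GaloisImage.KolyvaginPrimeLocalShape
import Literature.NumberTheory.Automorphic.TotallyRealModularityLargeImage
import HarnessLib

/-!
# Kolyvagin-prime LOCAL SHAPE, part (T): `#𝒯_𝔮 = N` for the cyclotomic transverse subgroup
# `𝒯_𝔮 = ker (H¹(K_𝔮, T̄) → H¹(K_𝔮(μ_ℓ), T̄))`, `ℓ = N𝔮`, at the Frobenius-class primes of `τ` —
# modulo the total ramification of `K_𝔮(μ_ℓ)/K_𝔮` (row T-R1-16-LOC, p18; p11's R1-16 binder (T))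

HONEST FRAMING (cell `b2b-bsdres`, run/shared/lean/b2b/bsd-rank1-residual/, verbatim in every
file): the goal of the cell is to DELETE the COMBINATION-SHAPED residual classes of the
Birch–Swinnerton-Dyer formula for ALL analytic-rank `≤ 1` elliptic curves over `ℚ` — "full BSD
formula for every rank `≤ 1` curve in class `C`" assembled STRICTLY from published theorems — so
that the rank-`≤ 1` remainder becomes exactly the CONSTRUCTION-SHAPED classes, which are TYPED
(missing-input `Prop`s), NOT attempted. This is not "finishing BSD". Team n1011 (N10/N11, the
additive block `X4 ∧ p = 3`): research route; TOOL theorems of local Galois cohomology, no class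
theorem, nothing booked, no mark changed.  No definition, no named fact in
this file: the one local input NOT in the tree — the mod-`ℓ` cyclotomic character of `K_𝔮` is onto
`(ℤ/ℓ)ˣ` already on the inertia group (`K_𝔮(μ_ℓ)/K_𝔮` totally ramified with group `(ℤ/ℓ)ˣ`;
Serre, *Local Fields* IV §4 Prop. 17–18 for `K = ℚ`; Rubin PCMI Def. 1.9.4) — is the explicit
hypothesis `hχI`; the sibling `KolyvaginPrimeTransverseSup.lean` types it as a cited fact for
`K = ℚ`.

## Content

* `mem_transverseSubgroup_cyclotomicField_iff` — `[φ] ∈ 𝒯 ↔ φ` is principal on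
  `Γ_{F(μ_ℓ)} = ker χ̄_ℓ` (`X11b.LocBridge.map_oneCocycleClass_eq_zero_iff`,
  `mem_range_absGaloisRestrict_cyclotomic_iff`); `natCard_transverseSubgroup_cyclotomicField_eq` —
  `#𝒯 = #H¹(Γ_F/ker χ̄_ℓ, M^{ker χ̄_ℓ})` (inflation–restriction, `infOne`).
* `natCard_continuousCohomology_one_eq_natCard_addMonoidHom_of_trivial` (`H¹(Q, A) ≅ Hom(Q, A)`
  for a discrete group acting trivially); `natCard_addMonoidHom_of_isCyclic`
  (`#Hom(Q, A) = #A[n]`, `Q` cyclic of order `n`).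
* `natCard_cyclotomicTransverse_of_mem_frobeniusClassPrimes` — **(T)**: for
  `𝔮 ∈ frobeniusClassPrimes ρ S τ N`, `M/(τ − 1)M ≃ ℤ/N`, `ℓ = N𝔮` prime, `(ℓ − 1)M = 0`
  (Rubin's "(q − 1)A = 0"), and `hχI`: `Nat.card (cyclotomicTransverse ρ (Sum.inr 𝔮)) = N`
  (Rubin PCMI Prop. 1.9.5 (1), `H¹_t(K, A) ≅ Hom(Gal(L/K), A^{ϕ=1})`, as a count);
  `natCard_transverse_of_primes_eq` — p11's binder shape.

References: K. Rubin, *Euler systems and Kolyvagin systems* (PCMI 18, 2011) Def. 1.9.4,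
Prop. 1.9.5 [Rubin2011]; B. Mazur, K. Rubin, Mem. AMS 799 (2004) Lemma 1.2.1 [MazurRubin2004];
J.-P. Serre, *Local Fields* (1979) Ch. IV §4 Prop. 17–18 [SerreLocalFields1979]; J.-P. Serre,
*Galois Cohomology* (1997) I §2.3, §2.6 [SerreGaloisCohomology1997].
-/

noncomputable section

open scoped Classical

universe u

namespace Summit.BirchSwinnertonDyer.Rank1Residual.GaloisImage

open CategoryTheory ContinuousCohomology Function Field ValuativeRel NumberField IsDedekindDomain
open Literature.NumberTheory.GaloisRepresentations
open Literature.NumberTheory.GaloisRepresentations.IsNonarchimedeanLocalField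
open _root_.TopRep
open Literature.NumberTheory.GaloisCohomology
open Literature.NumberTheory.Automorphic
open scoped NumberField

/-! ## The cyclotomic transverse subgroup as the classes principal on `ker χ̄_ℓ` -/

section Transverse

variable {F : Type u} [Field F] {M : Type u} [AddCommGroup M] [TopologicalSpace M] [DiscreteTopology M]
  (ρ : DiscreteGaloisModule F M) (ℓ : ℕ) [Fact ℓ.Prime] [NeZero (ℓ : F)]

/-- **Membership in the `F(μ_ℓ)`-transverse subgroup**: the class of `φ` dies in `H¹(F(μ_ℓ), M)`
iff `φ` is principal on `Γ_{F(μ_ℓ)} = ker χ̄_ℓ ≤ Γ_F` (`χ̄_ℓ` the mod-`ℓ` cyclotomic character;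
`X11b.LocBridge.map_oneCocycleClass_eq_zero_iff` — the kernel of a pull-back depends only on its
range — and `mem_range_absGaloisRestrict_cyclotomic_iff`). [cite: Rubin2011, Def. 1.9.4 (p. 14)] -/
theorem mem_transverseSubgroup_cyclotomicField_iff (φ : contOneCocycles ρ.toTopRep) :
    oneCocycleClass ρ.toTopRep φ ∈
        DiscreteGaloisModule.transverseSubgroup ρ (CyclotomicField ℓ F) ↔
      ∃ x : M, ∀ g : absoluteGaloisGroup F, modPCyclotomicCharacterZMod F ℓ g = 1 →
        φ.1 g = ρ g x - x := by
  refine (DiscreteGaloisModule.mem_transverseSubgroup_iff ρ (CyclotomicField ℓ F) _).trans ?_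
  refine (X11b.LocBridge.map_oneCocycleClass_eq_zero_iff ρ.toTopRep
    (DiscreteGaloisModule.toTopRep (GaloisRep.restrictField (CyclotomicField ℓ F) ρ))
    (absGaloisRestrict F (CyclotomicField ℓ F))
    (TopRep.ofHom ⟨ContinuousLinearMap.id ℤ M, fun _ => rfl⟩) Function.bijective_id φ).trans ?_
  constructor
  · rintro ⟨x, hx⟩
    refine ⟨x, fun g hg => ?_⟩
    obtain ⟨l, rfl⟩ : g ∈ (absGaloisRestrict F (CyclotomicField ℓ F)).range :=
      (mem_range_absGaloisRestrict_cyclotomic_iff ℓ (CyclotomicField ℓ F) g).2 hg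
    exact hx l
  · rintro ⟨x, hx⟩
    exact ⟨x, fun l => hx _ ((mem_range_absGaloisRestrict_cyclotomic_iff ℓ (CyclotomicField ℓ F) _).1
      ⟨l, rfl⟩)⟩

/-- The same with the kernel `H = ker χ̄_ℓ` as a subgroup: `[φ] ∈ 𝒯 ↔ res_H [φ] = 0`.
[cite: Rubin2011, Def. 1.9.4 (p. 14)] -/
theorem mem_transverseSubgroup_cyclotomicField_iff_resSubgroup_eq_zero
    (φ : contOneCocycles ρ.toTopRep) :
    oneCocycleClass ρ.toTopRep φ ∈
        DiscreteGaloisModule.transverseSubgroup ρ (CyclotomicField ℓ F) ↔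
      resSubgroup ρ.toTopRep (modPCyclotomicCharacterZMod F ℓ).ker 1 (oneCocycleClass ρ.toTopRep φ) = 0 := by
  rw [mem_transverseSubgroup_cyclotomicField_iff, resSubgroup_oneCocycleClass, oneCocycleClass_eq_zero_iff]
  constructor
  · rintro ⟨x, hx⟩
    exact ⟨x, fun h => by rw [contOneCocycles.pullback_apply]; exact hx h.1 h.2⟩
  · rintro ⟨x, hx⟩
    refine ⟨x, fun g hg => ?_⟩
    have h := hx ⟨g, hg⟩
    rw [contOneCocycles.pullback_apply] at h
    exact h

/-- `ker χ̄_ℓ` is the image of `Γ_{F(μ_ℓ)}`, hence closed in `Γ_F`. [folklore] -/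
theorem isClosed_ker_modPCyclotomicCharacterZMod :
    IsClosed ((modPCyclotomicCharacterZMod F ℓ).ker : Set (absoluteGaloisGroup F)) := by
  haveI := absoluteGaloisGroup_compactSpace (CyclotomicField ℓ F)
  have hset : ((modPCyclotomicCharacterZMod F ℓ).ker : Set (absoluteGaloisGroup F)) =
      Set.range (absGaloisRestrict F (CyclotomicField ℓ F)) := by
    ext g
    rw [SetLike.mem_coe, MonoidHom.mem_ker, Set.mem_range]
    exact ((mem_range_absGaloisRestrict_cyclotomic_iff ℓ (CyclotomicField ℓ F) g).symm.trans
      MonoidHom.mem_range)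
  rw [hset]
  exact (isCompact_range (absGaloisRestrict F (CyclotomicField ℓ F)).continuous).isClosed

/-- **`#𝒯 = #H¹(Γ_F / Γ_{F(μ_ℓ)}, M^{Γ_{F(μ_ℓ)}})`** (inflation–restriction: the transverse
subgroup is the image of the injective inflation from the finite quotient
`Gal(F(μ_ℓ)/F) = Γ_F/ker χ̄_ℓ`), for a finite `M`.  Rubin PCMI Prop. 1.9.5 (1), first step.
[cite: Rubin2011, Prop. 1.9.5 (1) (p. 16)] -/
theorem natCard_transverseSubgroup_cyclotomicField_eq [Finite M] :
    Nat.card (DiscreteGaloisModule.transverseSubgroup ρ (CyclotomicField ℓ F)) =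
      Nat.card (continuousCohomology 1
        (ContinuousRep.quotientInvariants (modPCyclotomicCharacterZMod F ℓ).ker ρ).toTopRep) := by
  haveI := absoluteGaloisGroup_compactSpace F
  haveI : IsClosed ((modPCyclotomicCharacterZMod F ℓ).ker : Set (absoluteGaloisGroup F)) :=
    isClosed_ker_modPCyclotomicCharacterZMod ℓ
  set N : Subgroup (absoluteGaloisGroup F) := (modPCyclotomicCharacterZMod F ℓ).ker
  have hex := infOne_exact_resSubgroup N ρ
  have hmem : ∀ c : galoisCohomology ρ 1,
      c ∈ DiscreteGaloisModule.transverseSubgroup ρ (CyclotomicField ℓ F) ↔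
        c ∈ Set.range (infOne N ρ) := by
    intro c
    obtain ⟨φ, rfl⟩ := oneCocycleClass_surjective ρ.toTopRep c
    exact (mem_transverseSubgroup_cyclotomicField_iff_resSubgroup_eq_zero ρ ℓ φ).trans (hex _)
  have e : continuousCohomology 1 (ρ.quotientInvariants N).toTopRep ≃
      DiscreteGaloisModule.transverseSubgroup ρ (CyclotomicField ℓ F) :=
    Equiv.ofBijective (fun x => ⟨infOne N ρ x, (hmem _).mpr ⟨x, rfl⟩⟩)
      ⟨fun x y hxy => infOne_injective N ρ (congrArg Subtype.val hxy),
        fun c => by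
          obtain ⟨x, hx⟩ := (hmem c.1).mp c.2
          exact ⟨x, Subtype.ext hx⟩⟩
  exact (Nat.card_congr e).symm

end Transverse

/-! ## `H¹` of a finite discrete group acting trivially = homomorphisms -/

section TrivialAction

variable {Q : Type u} [Group Q] [TopologicalSpace Q] [IsTopologicalGroup Q] [DiscreteTopology Q]
  {A : Type u} [AddCommGroup A] [TopologicalSpace A] [DiscreteTopology A]

/-- **`H¹(Q, A) ≅ Hom(Q, A)` for a discrete group `Q` acting TRIVIALLY on `A`**: crossed
homomorphisms are homomorphisms, the only coboundary is `0`, every homomorphism is continuous.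
(Serre, *Galois Cohomology* I §2.3 Remark; here as a count.) [folklore] -/
theorem natCard_continuousCohomology_one_eq_natCard_addMonoidHom_of_trivial
    (τ : ContinuousRep Q ℤ A) (htriv : ∀ (q : Q) (a : A), τ q a = a) :
    Nat.card (continuousCohomology 1 τ.toTopRep) = Nat.card (Additive Q →+ A) := by
  -- classes ↔ cocycles
  have hinj : Function.Injective (oneCocycleClass τ.toTopRep) := by
    intro φ ψ h
    have h0 : oneCocycleClass τ.toTopRep (φ - ψ) = 0 := by rw [oneCocycleClass_sub, h, sub_self]
    obtain ⟨v, hv⟩ := (oneCocycleClass_eq_zero_iff _ _).1 h0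
    apply Subtype.ext
    ext g
    have hg := hv g
    have htv : τ.toTopRep.ρ g v = v := htriv g v
    rw [htv, sub_self] at hg
    -- `hg : (φ - ψ).1 g = 0`
    have : (φ.1 - ψ.1) g = 0 := hg
    rwa [ContinuousMap.sub_apply, sub_eq_zero] at this
  have e1 : contOneCocycles τ.toTopRep ≃ continuousCohomology 1 τ.toTopRep :=
    Equiv.ofBijective _ ⟨hinj, oneCocycleClass_surjective _⟩
  -- cocycles ↔ homomorphisms
  have hφmul : ∀ (φ : contOneCocycles τ.toTopRep) (g h : Q), φ.1 (g * h) = φ.1 g + φ.1 h :=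
    fun φ g h => by
      have := φ.2 g h
      rw [this]
      exact congrArg _ (htriv g _)
  have e2 : contOneCocycles τ.toTopRep ≃ (Additive Q →+ A) :=
    { toFun := fun φ =>
        { toFun := fun q => φ.1 (Additive.toMul q)
          map_zero' := by
            have h := hφmul φ 1 1
            rw [mul_one] at h
            -- `φ 1 = φ 1 + φ 1`
            have : φ.1 1 = 0 := by
              have h' : φ.1 1 + φ.1 1 = φ.1 1 + 0 := by rw [add_zero]; exact h.symm
              exact add_left_cancel h'
            exact this
          map_add' := fun a b => hφmul φ (Additive.toMul a) (Additive.toMul b) }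
      invFun := fun f =>
        ⟨⟨fun q => f (Additive.ofMul q), continuous_of_discreteTopology⟩, fun g h => by
          change f (Additive.ofMul (g * h)) = f (Additive.ofMul g) + τ.toTopRep.ρ g (f (Additive.ofMul h))
          rw [ofMul_mul, map_add]
          exact congrArg _ (htriv g _).symm⟩
      left_inv := fun φ => Subtype.ext (ContinuousMap.ext fun _ => rfl)
      right_inv := fun f => AddMonoidHom.ext fun _ => rfl }
  rw [← Nat.card_congr e1, Nat.card_congr e2]

omit [TopologicalSpace Q] [IsTopologicalGroup Q] [DiscreteTopology Q] [TopologicalSpace A]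
  [DiscreteTopology A] in
/-- **`#Hom(Q, A) = #{a ∈ A | n·a = 0}` for a cyclic group `Q` of order `n`** (a homomorphism is
the image of a generator, any `n`-torsion element occurs). [folklore] -/
theorem natCard_addMonoidHom_of_isCyclic [Finite Q] [IsCyclic Q] :
    Nat.card (Additive Q →+ A) = Nat.card {a : A // (Nat.card Q : ℤ) • a = 0} := by
  have hcyc : IsAddCyclic (Additive Q) := inferInstance
  let e : ZMod (Nat.card (Additive Q)) ≃+ Additive Q := zmodAddCyclicAddEquiv hcyc
  have hcard : Nat.card (Additive Q) = Nat.card Q := Nat.card_congr Additive.toMul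
  -- `(Additive Q →+ A) ≃ (ZMod n →+ A) ≃ {f : ℤ →+ A // f n = 0} ≃ {a // n • a = 0}`
  have e1 : (Additive Q →+ A) ≃ (ZMod (Nat.card (Additive Q)) →+ A) :=
    { toFun := fun f => f.comp e.toAddMonoidHom
      invFun := fun g => g.comp e.symm.toAddMonoidHom
      left_inv := fun f => AddMonoidHom.ext fun x => by
        change f (e (e.symm x)) = f x
        rw [e.apply_symm_apply]
      right_inv := fun g => AddMonoidHom.ext fun x => by
        change g (e.symm (e x)) = g x
        rw [e.symm_apply_apply] }
  have e2 : (ZMod (Nat.card (Additive Q)) →+ A) ≃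
      {f : ℤ →+ A // f (Nat.card (Additive Q)) = 0} := (ZMod.lift (Nat.card (Additive Q))).symm
  have e3 : {f : ℤ →+ A // f (Nat.card (Additive Q)) = 0} ≃ {a : A // (Nat.card Q : ℤ) • a = 0} :=
    { toFun := fun f => ⟨f.1 1, by
        obtain ⟨g, hg⟩ := f
        change (Nat.card Q : ℤ) • g 1 = 0
        rw [← nsmul_one (Nat.card (Additive Q)), map_nsmul, hcard] at hg
        rw [natCast_zsmul]
        exact hg⟩
      invFun := fun a => ⟨(zmultiplesHom A) a.1, by
        rw [zmultiplesHom_apply, hcard]; exact a.2⟩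
      left_inv := fun f => Subtype.ext (by
        apply AddMonoidHom.ext_int
        change (zmultiplesHom A) (f.1 1) 1 = f.1 1
        rw [zmultiplesHom_apply, one_zsmul])
      right_inv := fun a => Subtype.ext (by
        change (zmultiplesHom A) a.1 1 = a.1
        rw [zmultiplesHom_apply, one_zsmul]) }
  exact Nat.card_congr (e1.trans (e2.trans e3))

end TrivialAction

/-! ## (T) at the Kolyvagin primes relative to `τ`: `#𝒯_𝔮 = N`, modulo the total ramification of
`K_𝔮(μ_ℓ)/K_𝔮` (`ℓ = N𝔮`), entered as the hypothesis `hχI` (the mod-`ℓ` cyclotomic character is onto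
on the inertia group of `K_𝔮`; Serre, *Local Fields* IV §4 Prop. 17 for `K = ℚ`) -/

section TransverseCount

variable {K : Type u} [Field K] [NumberField K] {M : Type u} [AddCommGroup M] [TopologicalSpace M]
  [DiscreteTopology M] [Finite M] (ρ : DiscreteGaloisModule K M)

omit [Finite M] in
/-- On an unramified local module, `M^{ker χ̄_ℓ} = M^{Γ}` when `χ̄_ℓ` is already onto on the inertia
group (`Γ = I · ker χ̄_ℓ`). [folklore] -/
theorem apply_eq_self_of_forall_ker {F : Type u} [Field F] [ValuativeRel F] [TopologicalSpace F]
    [IsNonarchimedeanLocalField F] (ρF : DiscreteGaloisModule F M) (ℓ : ℕ) [Fact ℓ.Prime] [NeZero (ℓ : F)]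
    (hI : ∀ t ∈ absInertia F, ∀ m : M, ρF t m = m)
    (hχI : ∀ u : (ZMod ℓ)ˣ, ∃ t ∈ absInertia F, modPCyclotomicCharacterZMod F ℓ t = u)
    (g : absoluteGaloisGroup F) (m : M)
    (hm : ∀ h ∈ (modPCyclotomicCharacterZMod F ℓ).ker, ρF h m = m) : ρF g m = m := by
  obtain ⟨t, ht, htg⟩ := hχI (modPCyclotomicCharacterZMod F ℓ g)
  have hker : t⁻¹ * g ∈ (modPCyclotomicCharacterZMod F ℓ).ker := by
    rw [MonoidHom.mem_ker, map_mul, map_inv, htg, inv_mul_cancel]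
  calc ρF g m = ρF (t * (t⁻¹ * g)) m := by rw [mul_inv_cancel_left]
    _ = ρF t (ρF (t⁻¹ * g) m) := by rw [map_mul, Module.End.mul_apply]
    _ = m := by rw [hm _ hker, hI t ht m]

/-- **(T) — `#𝒯_𝔮 = N` at a Kolyvagin prime `𝔮` relative to `τ`, MODULO the total ramification of
`K_𝔮(μ_ℓ)/K_𝔮` (`ℓ = N𝔮` prime).**  For `𝔮 ∈ frobeniusClassPrimes ρ S τ N` with
`M/(τ − 1)M ≃ ℤ/N`, `ℓ = N𝔮` prime, `(ℓ − 1)·M = 0` (Rubin's hypothesis "(q − 1)A = 0" of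
Prop. 1.9.5), and the mod-`ℓ` cyclotomic character of `K_𝔮` ONTO on the inertia group (hypothesis
`hχI`: `K_𝔮(μ_ℓ)/K_𝔮` totally ramified with group `(ℤ/ℓ)ˣ` — Serre, *Local Fields* IV §4
Prop. 17–18 for `K = ℚ`; the one local input of this row not in the tree), the cyclotomic
transverse subgroup `𝒯_𝔮 = ker (H¹(K_𝔮, M) → H¹(K_𝔮(μ_ℓ), M))` has exactly `N` elements:
`𝒯 ≅ H¹(Gal(K_𝔮(μ_ℓ)/K_𝔮), M^{Γ_{K_𝔮(μ_ℓ)}})` (inflation–restriction,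
`natCard_transverseSubgroup_cyclotomicField_eq`), the group `Gal = Γ/ker χ̄_ℓ ≅ (ℤ/ℓ)ˣ` is cyclic
of order `ℓ − 1` and acts trivially on `M^{ker χ̄_ℓ} = M^{Γ_{K_𝔮}}` (`apply_eq_self_of_forall_ker`),
so `#𝒯 = #Hom(ℤ/(ℓ−1), M^{Γ_{K_𝔮}}) = #M^{Γ_{K_𝔮}}` (`(ℓ − 1)M = 0`) `= N`
(`natCard_invariants_toLocal_of_mem_frobeniusClassPrimes`).  Rubin PCMI Prop. 1.9.5 (1)
(`H¹_t(K, A) ≅ Hom(Gal(L/K), A^{ϕ=1})`) as a count; p11's binder (T) of R1-16 at `N = p`, `K = ℚ`.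
[cite: Rubin2011, Prop. 1.9.5 (1) (p. 16) and Def. 1.9.4 (p. 14)] [cite: SerreLocalFields1979, Ch. IV §4, Prop. 17] -/
theorem natCard_cyclotomicTransverse_of_mem_frobeniusClassPrimes
    {S : Set (HeightOneSpectrum (𝓞 K))} {τ : absoluteGaloisGroup K} {N : ℕ}
    {q : HeightOneSpectrum (𝓞 K)} (hq : q ∈ frobeniusClassPrimes ρ S τ N)
    (hτ : Nonempty (cokerSubOne ρ τ ≃+ ZMod N))
    [Fact (Ideal.absNorm q.asIdeal).Prime] [NeZero ((Ideal.absNorm q.asIdeal : ℕ) : q.adicCompletion K)]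
    (hM : ∀ m : M, (Ideal.absNorm q.asIdeal - 1) • m = 0)
    (hχI : ∀ u : (ZMod (Ideal.absNorm q.asIdeal))ˣ, ∃ t ∈ absInertia (q.adicCompletion K),
      modPCyclotomicCharacterZMod (q.adicCompletion K) (Ideal.absNorm q.asIdeal) t = u) :
    Nat.card (cyclotomicTransverse ρ (Sum.inr q)) = N := by
  classical
  set L := q.adicCompletion K
  set ℓ := Ideal.absNorm q.asIdeal
  set ρq := GaloisRep.toLocal q ρ
  haveI := absoluteGaloisGroup_compactSpace L
  -- the local inertia group acts trivially on `M`
  have hI : ∀ t ∈ absInertia L, ∀ m : M, ρq t m = m := by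
    intro t ht m
    have h := (GaloisRep.isUnramifiedAt_iff_toLocal_holds q ρ).1 hq.2.2.1 t ht
    rw [h]
    rfl
  rw [cyclotomicTransverse_inr]
  change Nat.card (DiscreteGaloisModule.transverseSubgroup ρq (CyclotomicField ℓ L)) = N
  rw [natCard_transverseSubgroup_cyclotomicField_eq ρq ℓ]
  -- the quotient `Γ_L / ker χ̄_ℓ ≃ (ℤ/ℓ)ˣ`: finite, discrete, cyclic of order `ℓ - 1`
  set χ := modPCyclotomicCharacterZMod L ℓ
  set H : Subgroup (absoluteGaloisGroup L) := χ.ker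
  have hsurj : Function.Surjective χ := fun u => by
    obtain ⟨t, -, ht⟩ := hχI u
    exact ⟨t, ht⟩
  let e : absoluteGaloisGroup L ⧸ H ≃* (ZMod ℓ)ˣ := QuotientGroup.quotientKerEquivOfSurjective χ hsurj
  haveI : Finite (absoluteGaloisGroup L ⧸ H) := Finite.of_equiv _ e.toEquiv.symm
  haveI : IsCyclic (absoluteGaloisGroup L ⧸ H) :=
    isCyclic_of_surjective e.symm.toMonoidHom e.symm.surjective
  have hcardQ : Nat.card (absoluteGaloisGroup L ⧸ H) = ℓ - 1 := by
    rw [Nat.card_congr e.toEquiv, Nat.card_eq_fintype_card, ZMod.card_units]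
  haveI : H.FiniteIndex := Subgroup.finiteIndex_of_finite_quotient
  have hHopen : IsOpen (H : Set (absoluteGaloisGroup L)) :=
    Subgroup.isOpen_of_isClosed_of_finiteIndex H (isClosed_ker_modPCyclotomicCharacterZMod ℓ)
  haveI : DiscreteTopology (absoluteGaloisGroup L ⧸ H) := QuotientGroup.discreteTopology hHopen
  -- the quotient acts trivially on `M^H = M^{Γ_L}`
  have htriv : ∀ (x : absoluteGaloisGroup L ⧸ H) (a : ρq.invariantsOf H),
      ρq.quotientInvariants H x a = a := by
    intro x a
    obtain ⟨g, rfl⟩ := QuotientGroup.mk_surjective x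
    apply Subtype.ext
    rw [ContinuousRep.quotientInvariants_apply_coe]
    exact apply_eq_self_of_forall_ker ρq ℓ hI hχI g a.1
      (fun h hh => (ContinuousRep.mem_invariantsOf_iff H ρq a.1).1 a.2 ⟨h, hh⟩)
  rw [natCard_continuousCohomology_one_eq_natCard_addMonoidHom_of_trivial _ htriv,
    natCard_addMonoidHom_of_isCyclic, hcardQ]
  -- every element of `M^H` is killed by `ℓ - 1`
  have hall : ∀ a : ρq.invariantsOf H, ((ℓ - 1 : ℕ) : ℤ) • a = 0 := fun a => by
    apply Subtype.ext
    rw [Submodule.coe_smul, Submodule.coe_zero, natCast_zsmul]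
    exact hM a.1
  rw [Nat.card_congr (Equiv.subtypeUnivEquiv hall)]
  -- `M^H = M^{Γ_L}`, counted in `natCard_invariants_toLocal_of_mem_frobeniusClassPrimes`
  have e' : ρq.invariantsOf H ≃ ρq.toTopRep.ρ.invariants :=
    { toFun := fun a => ⟨a.1, fun g => apply_eq_self_of_forall_ker ρq ℓ hI hχI g a.1
        (fun h hh => (ContinuousRep.mem_invariantsOf_iff H ρq a.1).1 a.2 ⟨h, hh⟩)⟩
      invFun := fun v => ⟨v.1, (ContinuousRep.mem_invariantsOf_iff H ρq v.1).2 fun h => v.2 h.1⟩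
      left_inv := fun _ => rfl
      right_inv := fun _ => rfl }
  rw [Nat.card_congr e']
  exact natCard_invariants_toLocal_of_mem_frobeniusClassPrimes ρ hq hτ

/-- **p11's binder (T) of R1-16, literally** (for a Kolyvagin datum with
`D.primes = frobeniusClassPrimes ρ S τ N` and `D.transverse = cyclotomicTransverse ρ`), modulo the
total ramification hypothesis `hχI` at each prime and `(N𝔮 − 1)M = 0`.
[cite: Rubin2011, Prop. 1.9.5 (1) (p. 16)] -/
theorem natCard_transverse_of_primes_eq {D : KolyvaginDatum ρ}
    {S : Set (HeightOneSpectrum (𝓞 K))} {τ : absoluteGaloisGroup K} {N : ℕ}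
    (hP : D.primes = frobeniusClassPrimes ρ S τ N) (hT : D.transverse = cyclotomicTransverse ρ)
    (hτ : Nonempty (cokerSubOne ρ τ ≃+ ZMod N))
    (hℓ : ∀ q ∈ D.primes, (Ideal.absNorm q.asIdeal).Prime)
    (hM : ∀ q ∈ D.primes, ∀ m : M, (Ideal.absNorm q.asIdeal - 1) • m = 0)
    (hχI : ∀ q ∈ D.primes, ∀ [Fact (Ideal.absNorm q.asIdeal).Prime]
      [NeZero ((Ideal.absNorm q.asIdeal : ℕ) : q.adicCompletion K)],
      ∀ u : (ZMod (Ideal.absNorm q.asIdeal))ˣ, ∃ t ∈ absInertia (q.adicCompletion K),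
        modPCyclotomicCharacterZMod (q.adicCompletion K) (Ideal.absNorm q.asIdeal) t = u) :
    ∀ q ∈ D.primes, Nat.card (D.transverse (Sum.inr q)) = N := by
  intro q hq
  haveI : Fact (Ideal.absNorm q.asIdeal).Prime := ⟨hℓ q hq⟩
  haveI : CharZero (q.adicCompletion K) :=
    charZero_of_injective_algebraMap (algebraMap K (q.adicCompletion K)).injective
  haveI : NeZero ((Ideal.absNorm q.asIdeal : ℕ) : q.adicCompletion K) :=
    ⟨Nat.cast_ne_zero.2 (hℓ q hq).ne_zero⟩
  rw [hT]
  exact natCard_cyclotomicTransverse_of_mem_frobeniusClassPrimes ρ (hP ▸ hq) hτ (hM q hq)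
    (hχI q hq)

end TransverseCount

end Summit.BirchSwinnertonDyer.Rank1Residual.GaloisImage

end
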